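import Summits.CriticalPhenomena.PercolationContinuityZ3.Theorems.PercNearOneGluingNoHeavyLowerTailAntitheticCycleOplusBoxes
import Summits.CriticalPhenomena.PercolationContinuityZ3.Theorems.PercNearOneGluingNoHeavyLowerTailAntitheticBoxes
import HarnessLib

/-!
# `NoHeavyLowerTail` (stmt-CriticalPhenomena-4575) — antithetic cluster pairs: THEOREM ⊕-CYCLE in EXTENSION FORM with FORCED-RED pairs
# (HOME/MEMO-gen62.md §2 (P1)/(P4), prim-hp-2 gen 62)

Support file (`--supports stmt-CriticalPhenomena-4575`, hull-port prover `prim-hp-2`, gen 62).  No definitions, no named facts, no sorries;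
standard axioms.  Setting of …AntitheticCycleOplusBoxes: cycle `v 0 = s, …, v (n-1)` (`n ≥ 3`), `C = Cyc.edgeSet n v`, `P = v p` (`0 < p < n`).

`Antithetic.Cyc.oplus_cycle_ext` generalises `Cyc.oplus_cycle_stub` (…AntitheticCycleOplus) in two directions needed by the fibres of the
block-freezing step (PR4) on larger graphs and by pendant TREES:
* an arbitrary EXTENSION `E'` of the cycle — any edge set such that (hev) the event `{P ∈ X}` computed in `E'` equals the one computed on the
  cycle, and (hdomx) red domination transfers from the cycle to `E'` for colourings that are opposite off the cycle (both hold for the cycle with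
  pendant paths/trees hanging anywhere, by `Antithetic.Box.mem_path_iff` / `dom_path` / `dom_insert_leaf`);
* a set of FORCED-RED cycle pairs (indices `frc`): the sum runs over the colourings in which those pairs are red.
Conclusion: for all super-odd twisted-monotone `K₁, K₂`, `0 ≤ Σ_{T : forced pairs red, P ∈ X_{E'} T} K₁K₂(X_{E'} T, Y_{E'} T)`.  Proof = the PTR
boxes of …AntitheticCycleOplusBoxes with the forced indices added to the red pattern (boxes whose blue pair is forced are dropped);
`Cyc.dom_box` already allows extra forced reds; `Antithetic.Box.boxes_sum_nonneg` sums up.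
[cite: VandenbergHaggstromKahn2005, §1 p. 6 ("Harris' inequality"), §1 p. 3 (open cluster `C_s`)]
-/

noncomputable section

namespace Summit.CriticalPhenomena.PercolationContinuityZ3.Theorems

open Literature.Probability.Percolation
open scoped Classical

namespace Antithetic

namespace Cyc

variable {V : Type*} [Fintype V] {n : ℕ} {v : ℕ → V} (hn : 3 ≤ n) (hinj : ∀ i j, i < n → j < n → v i = v j → i = j) (hper : v n = v 0)
  {p : ℕ} (hp0 : 0 < p) (hpn : p < n)
include hn hinj hper hp0 hpn

/-- **THEOREM ⊕-CYCLE, extension form with forced-red pairs.**  `E'` any edge set on which the event `{P ∈ X}` and red domination are those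
of the cycle (hev, hdomx — e.g. the cycle with pendant trees), `frc` a set of forced-red cycle indices.  Then for all super-odd
twisted-monotone `K₁, K₂`: `0 ≤ Σ_{T : (∀ i < n, frc i → edge v i ∈ T) ∧ P ∈ X_{E'} T} K₁(X_{E'} T, Y_{E'} T)·K₂(X_{E'} T, Y_{E'} T)`. [this work] -/
theorem oplus_cycle_ext (frc : ℕ → Prop) (E' : Set (Sym2 V))
    (hev : ∀ T : Set (Sym2 V), v p ∈ openCluster (T ∩ E') (v 0) ↔ v p ∈ openCluster (T ∩ edgeSet n v) (v 0))
    (hdomx : ∀ T T' : Set (Sym2 V), (∀ e ∉ edgeSet n v, (e ∈ T' ↔ e ∉ T)) →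
      openCluster (T'ᶜ ∩ edgeSet n v) (v 0) ⊆ openCluster (T ∩ edgeSet n v) (v 0) →
      openCluster (T'ᶜ ∩ E') (v 0) ⊆ openCluster (T ∩ E') (v 0))
    (K₁ K₂ : Set V → Set V → ℝ)
    (hK₁ : ∀ ⦃P P' Q Q' : Set V⦄, P ⊆ P' → Q' ⊆ Q → K₁ P Q ≤ K₁ P' Q') (hso₁ : ∀ P Q, 0 ≤ K₁ P Q + K₁ Q P)
    (hK₂ : ∀ ⦃P P' Q Q' : Set V⦄, P ⊆ P' → Q' ⊆ Q → K₂ P Q ≤ K₂ P' Q') (hso₂ : ∀ P Q, 0 ≤ K₂ P Q + K₂ Q P) :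
    0 ≤ ∑ ω ∈ Finset.univ.filter (fun ω : Set (Sym2 V) =>
        (∀ i, i < n → frc i → edge v i ∈ ω) ∧ v p ∈ openCluster (ω ∩ E') (v 0)),
      K₁ (openCluster (ω ∩ E') (v 0)) (openCluster (ωᶜ ∩ E') (v 0)) * K₂ (openCluster (ω ∩ E') (v 0)) (openCluster (ωᶜ ∩ E') (v 0)) := by
  -- the boxes, indexed by `c : Fin (n+1)` with `c = n` (TOP) or `c = k < n` not forced (BOX `k`); forced indices are added to the red pattern
  let arc : ℕ → ℕ → Prop := fun k i => (k < p ∧ k < i) ∨ (p ≤ k ∧ i < k)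
  let red : ℕ → ℕ → Prop := fun k i => k = n ∨ arc k i ∨ frc i
  let C := {c : Fin (n + 1) // c.val = n ∨ ¬ frc c.val}
  let Fix : C → Set (Sym2 V) := fun c => {e | ∃ i, i < n ∧ (i = c.1.val ∨ red c.1.val i) ∧ e = edge v i}
  let N : C → Set (Sym2 V) := fun c => {e | ∃ i, i < n ∧ red c.1.val i ∧ e = edge v i}
  have hedge_inj : ∀ {i i' : ℕ}, i < n → i' < n → edge v i = edge v i' → i = i' := fun hi hi' h => edge_inj hn hinj hper hi hi' h
  have hmemN : ∀ (k : ℕ) (hk : k = n ∨ ¬ frc k) (hk' : k < n + 1) (i : ℕ), i < n →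
      (edge v i ∈ N ⟨⟨k, hk'⟩, hk⟩ ↔ red k i) := by
    intro k hk hk' i hi
    constructor
    · rintro ⟨i', hi', hred, he⟩
      rwa [hedge_inj hi hi' he]
    · exact fun h => ⟨i, hi, h, rfl⟩
  have hmem_iff : ∀ (k : ℕ) (hk : k = n ∨ ¬ frc k) (hk' : k < n + 1) (ω : Set (Sym2 V)),
      (∀ e ∈ Fix ⟨⟨k, hk'⟩, hk⟩, (e ∈ ω ↔ e ∈ N ⟨⟨k, hk'⟩, hk⟩)) ↔
        ((k < n → edge v k ∉ ω) ∧ ∀ i, i < n → red k i → edge v i ∈ ω) := by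
    intro k hk hk' ω
    constructor
    · intro h
      refine ⟨fun hkn hkω => ?_, fun i hi hred => ?_⟩
      · have h1 := (h (edge v k) ⟨k, hkn, Or.inl rfl, rfl⟩).1 hkω
        rw [hmemN k hk hk' k hkn] at h1
        rcases h1 with h1 | h1 | h1
        · omega
        · rcases h1 with ⟨-, h1⟩ | ⟨-, h1⟩ <;> omega
        · rcases hk with h2 | h2
          · omega
          · exact h2 h1
      · exact (h (edge v i) ⟨i, hi, Or.inr hred, rfl⟩).2 ((hmemN k hk hk' i hi).2 hred)
    · rintro ⟨hblue, hreds⟩ e ⟨i, hi, hor, rfl⟩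
      rw [hmemN k hk hk' i hi]
      rcases hor with rfl | hred
      · constructor
        · exact fun h => absurd h (hblue hi)
        · intro h
          rcases h with h | h | h
          · omega
          · rcases h with ⟨-, h⟩ | ⟨-, h⟩ <;> omega
          · rcases hk with h2 | h2
            · omega
            · exact absurd h h2
      · exact iff_of_true (hreds i hi hred) hred
  have hFix_cyc : ∀ (c : C) (e : Sym2 V), e ∈ Fix c → e ∈ edgeSet n v := by
    rintro c e ⟨i, hi, -, rfl⟩
    exact ⟨i, hi, rfl⟩
  refine Box.boxes_sum_nonneg E' (v 0) _ Fix N ?_ ?_ ?_ ?_ hK₁ hso₁ hK₂ hso₂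
  · -- cover
    intro ω hω
    obtain ⟨hfrc, hP'⟩ := (Finset.mem_filter.1 hω).2
    have hP := (hev ω).1 hP'
    rcases oplus_cover hn hinj hper hp0 hpn ω hP with htop | ⟨k, hk, hbk, hbox⟩
    · refine ⟨⟨⟨n, Nat.lt_succ_self n⟩, Or.inl rfl⟩, (hmem_iff n (Or.inl rfl) _ ω).2 ⟨fun h => absurd h (lt_irrefl n), fun i hi _ => htop i hi⟩⟩
    · have hkf : ¬ frc k := fun h => hbk (hfrc k hk h)
      refine ⟨⟨⟨k, Nat.lt_succ_of_lt hk⟩, Or.inr hkf⟩, (hmem_iff k (Or.inr hkf) _ ω).2 ⟨fun _ => hbk, fun i hi hred => ?_⟩⟩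
      rcases hred with h | h | h
      · exact absurd h (Nat.ne_of_lt hk)
      · exact hbox i hi h
      · exact hfrc i hi h
  · -- inside
    rintro ⟨⟨k, hk'⟩, hk⟩ ω hmem
    rw [Finset.mem_filter, hev ω]
    obtain ⟨hblue, hreds⟩ := (hmem_iff k hk hk' ω).1 hmem
    refine ⟨Finset.mem_univ _, fun i hi hf => hreds i hi (Or.inr (Or.inr hf)), ?_⟩
    by_cases hkn : k < n
    · exact mem_X_of_box hn hinj hper hp0 hpn ω hkn fun i hi harc => hreds i hi (Or.inr (Or.inl harc))
    · have hcn : k = n := by omega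
      exact mem_X_of_top hn hinj hper hp0 hpn ω fun i hi => hreds i hi (Or.inl hcn)
  · -- uniqueness
    rintro ⟨⟨k, hk'⟩, hk⟩ ⟨⟨k₂, hk₂'⟩, hk₂⟩ ω hmem hmem'
    obtain ⟨hblue, hreds⟩ := (hmem_iff k hk hk' ω).1 hmem
    obtain ⟨hblue', hreds'⟩ := (hmem_iff k₂ hk₂ hk₂' ω).1 hmem'
    have hkk : k = k₂ := by
      by_cases hc : k < n
      · by_cases hc' : k₂ < n
        · exact box_uniq (p := p) ω hc hc' (hblue hc) (fun i hi harc => hreds i hi (Or.inr (Or.inl harc))) (hblue' hc')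
            (fun i hi harc => hreds' i hi (Or.inr (Or.inl harc)))
        · have hcn' : k₂ = n := by omega
          exact absurd (hreds' k hc (Or.inl hcn')) (hblue hc)
      · have hcn : k = n := by omega
        by_cases hc' : k₂ < n
        · exact absurd (hreds k₂ hc' (Or.inl hcn)) (hblue' hc')
        · omega
    subst hkk
    rfl
  · -- red domination: on the cycle by `dom_box` / `dom_top` (forced reds allowed), then transferred to `E'` by hdomx
    rintro ⟨⟨k, hk'⟩, hk⟩ ω ω' hmem hmem' hflip
    obtain ⟨hblue, hreds⟩ := (hmem_iff k hk hk' ω).1 hmem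
    obtain ⟨hblue', hreds'⟩ := (hmem_iff k hk hk' ω').1 hmem'
    refine hdomx ω ω' (fun e he => hflip e fun hmemF => he (hFix_cyc _ e hmemF)) ?_
    by_cases hkn : k < n
    · refine dom_box hn hinj hper ω ω' (k := k) (red k) ?_ hreds hreds' fun i hi hik hnred => ?_
      · by_cases hkp : k < p
        · exact Or.inl ⟨by omega, fun i hki hin => Or.inr (Or.inl (Or.inl ⟨hkp, hki⟩))⟩
        · exact Or.inr ⟨by omega, fun i hik => Or.inr (Or.inl (Or.inr ⟨by omega, hik⟩))⟩
      · refine hflip (edge v i) fun hmemF => ?_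
        obtain ⟨i', hi', hor, he⟩ := hmemF
        have := hedge_inj hi hi' he
        subst this
        rcases hor with h | h
        · exact hik h
        · exact hnred h
    · have hcn : k = n := by omega
      exact dom_top hn hinj hper ω ω' fun i hi => hreds' i hi (Or.inl hcn)

end Cyc

end Antithetic

end Summit.CriticalPhenomena.PercolationContinuityZ3.Theorems
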